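import Literature.Topology.FourManifolds.FishtailPathShell
import Literature.Topology.FourManifolds.FishtailDiscPolar
import HarnessLib

/-!
# Position functions along Gompf's disc

Infrastructure for the explicit fishtail neighbourhood (R. Gompf, *More Cappell–Shaneson spheres
are standard*, Algebr. Geom. Topol. 10 (2010), proof of Thm 2.1 and Lemma 2.2; the named fact
`Literature.Topology.FourManifolds.gompf2010_framedTwist`). The tube about Gompf's disc `D` is
assembled from pieces each with its own position coordinate (latitude, chart radius, path angle,
height, leg length); along the master radius `r = |ζ|` of `D` these are smooth strictly monotone
functions, consecutive ones tied by the junction identities. This file provides the explicit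
functions and the monotone blending used where no explicit tie is available:

* `Literature.Topology.FourManifolds.angleUp r₀ r = π/4 + (3/2) arctan (r - r₀)` — increasing onto
  `(-π/2, π)`; `angleDown r₁ r = π/4 - (3/2) arctan (r - r₁)` — decreasing;
* `Literature.Topology.FourManifolds.blendFun χ f g = (1 - χ) f + χ g` with the derivative formula
  and **positivity of the derivative** when `f' , g' > 0`, `0 ≤ χ ≤ 1`, `χ' ≥ 0` and `f ≤ g`
  (`deriv_blendFun_pos`), the standard blend `stdBlend a b` (smooth transition on `[a, b]`) with
  its plateaus and `0 ≤ χ' `;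
* derivative facts: `hasDerivAt_footY` (`ρ/sin²`), `hasDerivAt_flatU` (`-ρ/cos²`).

Everything is proved; no named facts.

## References

* R. E. Gompf, *More Cappell–Shaneson spheres are standard*, Algebr. Geom. Topol. 10 (2010)
  1665–1681, proof of Thm 2.1 and Lemma 2.2. [GompfAGT2010]
-/

noncomputable section

open scoped Real ContDiff Topology
open Set Function Filter

namespace Literature.Topology.FourManifolds

/-! ### The master angles -/

section Angles

/-- **The increasing master angle** `π/4 + (3/2) arctan (r - r₀) ∈ (-π/2, π)`. [folklore] -/
def angleUp (r₀ r : ℝ) : ℝ := π / 4 + 3 / 2 * Real.arctan (r - r₀)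

/-- **The decreasing master angle** `π/4 - (3/2) arctan (r - r₁) ∈ (-π/2, π)`. [folklore] -/
def angleDown (r₁ r : ℝ) : ℝ := π / 4 - 3 / 2 * Real.arctan (r - r₁)

/-- Range of the increasing angle. [folklore] -/
theorem angleUp_mem (r₀ r : ℝ) : -(π / 2) < angleUp r₀ r ∧ angleUp r₀ r < π := by
  have h1 := Real.arctan_lt_pi_div_two (r - r₀)
  have h2 := Real.neg_pi_div_two_lt_arctan (r - r₀)
  unfold angleUp; constructor <;> linarith

/-- Range of the decreasing angle. [folklore] -/
theorem angleDown_mem (r₁ r : ℝ) : -(π / 2) < angleDown r₁ r ∧ angleDown r₁ r < π := by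
  have h1 := Real.arctan_lt_pi_div_two (r - r₁)
  have h2 := Real.neg_pi_div_two_lt_arctan (r - r₁)
  unfold angleDown; constructor <;> linarith

/-- Derivative of the increasing angle: `(3/2)/(1 + (r - r₀)²) > 0`. [folklore] -/
theorem hasDerivAt_angleUp (r₀ r : ℝ) : HasDerivAt (angleUp r₀) (3 / 2 * (1 / (1 + (r - r₀) ^ 2))) r := by
  unfold angleUp
  have h := ((Real.hasDerivAt_arctan (r - r₀)).comp r ((hasDerivAt_id r).sub_const r₀)).const_mul (3 / 2)
  simpa using h.const_add (π / 4)

/-- Derivative of the decreasing angle: `-(3/2)/(1 + (r - r₁)²) < 0`. [folklore] -/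
theorem hasDerivAt_angleDown (r₁ r : ℝ) : HasDerivAt (angleDown r₁) (-(3 / 2 * (1 / (1 + (r - r₁) ^ 2)))) r := by
  unfold angleDown
  have h := ((Real.hasDerivAt_arctan (r - r₁)).comp r ((hasDerivAt_id r).sub_const r₁)).const_mul (3 / 2)
  simpa using h.const_sub (π / 4)

/-- The increasing angle has positive derivative. [folklore] -/
theorem deriv_angleUp_pos (r₀ r : ℝ) : 0 < deriv (angleUp r₀) r := by
  rw [(hasDerivAt_angleUp r₀ r).deriv]; positivity

/-- The decreasing angle has negative derivative. [folklore] -/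
theorem deriv_angleDown_neg (r₁ r : ℝ) : deriv (angleDown r₁) r < 0 := by
  rw [(hasDerivAt_angleDown r₁ r).deriv]
  have : 0 < 3 / 2 * (1 / (1 + (r - r₁) ^ 2)) := by positivity
  linarith

/-- The angles are smooth. [folklore] -/
theorem contDiff_angleUp (r₀ : ℝ) : ContDiff ℝ ∞ (angleUp r₀) := by
  unfold angleUp; exact contDiff_const.add (contDiff_const.mul (Real.contDiff_arctan.comp (contDiff_id.sub contDiff_const)))

/-- The angles are smooth. [folklore] -/
theorem contDiff_angleDown (r₁ : ℝ) : ContDiff ℝ ∞ (angleDown r₁) := by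
  unfold angleDown; exact contDiff_const.sub (contDiff_const.mul (Real.contDiff_arctan.comp (contDiff_id.sub contDiff_const)))

/-- The increasing angle is strictly monotone. [folklore] -/
theorem strictMono_angleUp (r₀ : ℝ) : StrictMono (angleUp r₀) :=
  strictMono_of_deriv_pos (deriv_angleUp_pos r₀)

/-- The decreasing angle is strictly antitone. [folklore] -/
theorem strictAnti_angleDown (r₁ : ℝ) : StrictAnti (angleDown r₁) :=
  strictAnti_of_deriv_neg (deriv_angleDown_neg r₁)

end Angles

/-! ### Blending two position functions -/

section Blend

variable (χ f g : ℝ → ℝ)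

/-- **The blend** `(1 - χ) f + χ g`. [folklore] -/
def blendFun (r : ℝ) : ℝ := (1 - χ r) * f r + χ r * g r

variable {χ f g}

/-- Where `χ = 0` the blend is `f`. [folklore] -/
theorem blendFun_of_zero {r : ℝ} (h : χ r = 0) : blendFun χ f g r = f r := by simp [blendFun, h]

/-- Where `χ = 1` the blend is `g`. [folklore] -/
theorem blendFun_of_one {r : ℝ} (h : χ r = 1) : blendFun χ f g r = g r := by simp [blendFun, h]

/-- The derivative of the blend. [folklore] -/
theorem hasDerivAt_blendFun {r χ' f' g' : ℝ} (hχ : HasDerivAt χ χ' r) (hf : HasDerivAt f f' r) (hg : HasDerivAt g g' r) :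
    HasDerivAt (blendFun χ f g) ((1 - χ r) * f' + χ r * g' + χ' * (g r - f r)) r := by
  unfold blendFun
  have h1 : HasDerivAt (fun x ↦ (1 - χ x) * f x) ((0 - χ') * f r + (1 - χ r) * f') r :=
    ((hasDerivAt_const r (1:ℝ)).sub hχ).mul hf
  have h2 : HasDerivAt (fun x ↦ χ x * g x) (χ' * g r + χ r * g') r := hχ.mul hg
  exact (h1.add h2).congr_deriv (by ring)

/-- **Positivity of the blend's derivative**: `f', g' > 0`, `0 ≤ χ ≤ 1`, `0 ≤ χ'`, `f ≤ g`. [folklore] -/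
theorem deriv_blendFun_pos {r χ' f' g' : ℝ} (hχ : HasDerivAt χ χ' r) (hf : HasDerivAt f f' r) (hg : HasDerivAt g g' r)
    (hχ0 : 0 ≤ χ r) (hχ1 : χ r ≤ 1) (hχ' : 0 ≤ χ') (hf' : 0 < f') (hg' : 0 < g') (hfg : f r ≤ g r) :
    0 < deriv (blendFun χ f g) r := by
  rw [(hasDerivAt_blendFun hχ hf hg).deriv]
  have h3 : 0 ≤ χ' * (g r - f r) := mul_nonneg hχ' (by linarith)
  rcases hχ0.lt_or_eq with hpos | hzero
  · nlinarith [mul_pos hpos hg', mul_nonneg (sub_nonneg.2 hχ1) hf'.le]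
  · rw [← hzero]; nlinarith

/-- **Negativity of the blend's derivative**: `f', g' < 0`, `0 ≤ χ ≤ 1`, `0 ≤ χ'`, `g ≤ f`. [folklore] -/
theorem deriv_blendFun_neg {r χ' f' g' : ℝ} (hχ : HasDerivAt χ χ' r) (hf : HasDerivAt f f' r) (hg : HasDerivAt g g' r)
    (hχ0 : 0 ≤ χ r) (hχ1 : χ r ≤ 1) (hχ' : 0 ≤ χ') (hf' : f' < 0) (hg' : g' < 0) (hfg : g r ≤ f r) :
    deriv (blendFun χ f g) r < 0 := by
  rw [(hasDerivAt_blendFun hχ hf hg).deriv]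
  have h3 : χ' * (g r - f r) ≤ 0 := mul_nonpos_of_nonneg_of_nonpos hχ' (by linarith)
  rcases hχ0.lt_or_eq with hpos | hzero
  · nlinarith [mul_neg_of_pos_of_neg hpos hg', mul_nonpos_of_nonneg_of_nonpos (sub_nonneg.2 hχ1) hf'.le]
  · rw [← hzero]; nlinarith

/-- Smoothness of the blend. [folklore] -/
theorem contDiff_blendFun (hχ : ContDiff ℝ ∞ χ) (hf : ContDiff ℝ ∞ f) (hg : ContDiff ℝ ∞ g) : ContDiff ℝ ∞ (blendFun χ f g) := by
  unfold blendFun; exact ((contDiff_const.sub hχ).mul hf).add (hχ.mul hg)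

/-- Local smoothness of the blend. [folklore] -/
theorem contDiffAt_blendFun {r : ℝ} (hχ : ContDiffAt ℝ ∞ χ r) (hf : ContDiffAt ℝ ∞ f r) (hg : ContDiffAt ℝ ∞ g r) :
    ContDiffAt ℝ ∞ (blendFun χ f g) r := by
  unfold blendFun; exact ((contDiffAt_const.sub hχ).mul hf).add (hχ.mul hg)

/-- **The standard blend profile** `χ(r) = smoothTransition ((r - a)/(b - a))`: `0` for `r ≤ a`,
`1` for `r ≥ b`, values in `[0, 1]`, nonnegative derivative (`a < b`). [folklore] -/
def stdBlend (a b r : ℝ) : ℝ := Real.smoothTransition ((r - a) / (b - a))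

/-- `stdBlend = 0` left of `a`. [folklore] -/
theorem stdBlend_of_le {a b r : ℝ} (hab : a < b) (h : r ≤ a) : stdBlend a b r = 0 :=
  Real.smoothTransition.zero_of_nonpos (div_nonpos_of_nonpos_of_nonneg (by linarith) (by linarith))

/-- `stdBlend = 1` right of `b`. [folklore] -/
theorem stdBlend_of_ge {a b r : ℝ} (hab : a < b) (h : b ≤ r) : stdBlend a b r = 1 :=
  Real.smoothTransition.one_of_one_le ((one_le_div (by linarith)).2 (by linarith))

/-- `stdBlend ∈ [0, 1]`. [folklore] -/
theorem stdBlend_mem (a b r : ℝ) : 0 ≤ stdBlend a b r ∧ stdBlend a b r ≤ 1 :=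
  ⟨Real.smoothTransition.nonneg _, Real.smoothTransition.le_one _⟩

/-- `stdBlend` is smooth. [folklore] -/
theorem contDiff_stdBlend (a b : ℝ) : ContDiff ℝ ∞ (stdBlend a b) :=
  Real.smoothTransition.contDiff.comp ((contDiff_id.sub contDiff_const).div_const _)

/-- The derivative of `stdBlend` (chain rule). [folklore] -/
theorem hasDerivAt_stdBlend (a b r : ℝ) :
    HasDerivAt (stdBlend a b) (deriv Real.smoothTransition ((r - a) / (b - a)) * (1 / (b - a))) r := by
  unfold stdBlend
  have h1 : HasDerivAt (fun r : ℝ ↦ (r - a) / (b - a)) (1 / (b - a)) r := by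
    simpa using ((hasDerivAt_id r).sub_const a).div_const (b - a)
  have h2 : HasDerivAt Real.smoothTransition (deriv Real.smoothTransition ((r - a) / (b - a))) ((r - a) / (b - a)) :=
    ((Real.smoothTransition.contDiff (n := 1)).differentiable (by simp) _).hasDerivAt
  exact h2.comp r h1

/-- The derivative of `stdBlend` is nonnegative (`a < b`). [folklore] -/
theorem deriv_stdBlend_nonneg {a b : ℝ} (hab : a < b) (r : ℝ) :
    0 ≤ deriv Real.smoothTransition ((r - a) / (b - a)) * (1 / (b - a)) :=
  mul_nonneg (Real.smoothTransition.monotone.deriv_nonneg) (by rw [one_div]; exact inv_nonneg.2 (by linarith))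

end Blend

/-! ### Derivatives of the path position maps -/

section PathPos

variable {ρ : ℝ}

/-- `u₀'(ψ) = -ρ/cos²ψ` for `cos ψ ≠ 0`. [folklore] -/
theorem hasDerivAt_flatU {ψ : ℝ} (hc : Real.cos ψ ≠ 0) : HasDerivAt (flatU ρ) (-(ρ * (1 / Real.cos ψ ^ 2))) ψ := by
  unfold flatU
  simpa using ((Real.hasDerivAt_tan hc).const_mul ρ).const_sub (3 * ρ)

/-- `y'(ψ) = ρ/sin²ψ` for `sin ψ ≠ 0`. [folklore] -/
theorem hasDerivAt_footY' {ψ : ℝ} (hs : Real.sin ψ ≠ 0) : HasDerivAt (footY ρ) (ρ * (1 / Real.sin ψ ^ 2)) ψ := by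
  have h := (Real.hasDerivAt_cos ψ).div (Real.hasDerivAt_sin ψ) hs
  have h' : HasDerivAt (fun x ↦ ρ - ρ * (Real.cos x / Real.sin x))
      (-(ρ * ((-Real.sin ψ * Real.sin ψ - Real.cos ψ * Real.cos ψ) / Real.sin ψ ^ 2))) ψ :=
    (h.const_mul ρ).const_sub ρ
  refine h'.congr_deriv ?_
  have key : -Real.sin ψ * Real.sin ψ - Real.cos ψ * Real.cos ψ = -1 := by
    linear_combination (-1 : ℝ) * Real.sin_sq_add_cos_sq ψ
  rw [key]; ring

/-- `footY` is strictly increasing on `(0, π)`. [folklore] -/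
theorem strictMonoOn_footY (hρ : 0 < ρ) : StrictMonoOn (footY ρ) (Ioo 0 π) := by
  refine strictMonoOn_of_deriv_pos (convex_Ioo 0 π) ?_ fun x hx ↦ ?_
  · intro x hx
    exact (hasDerivAt_footY' (Real.sin_pos_of_pos_of_lt_pi hx.1 hx.2).ne').continuousAt.continuousWithinAt
  · rw [interior_Ioo] at hx
    have hs := Real.sin_pos_of_pos_of_lt_pi hx.1 hx.2
    rw [(hasDerivAt_footY' hs.ne').deriv]; positivity

/-- `flatU` is strictly decreasing on `(-π/2, π/2)`. [folklore] -/
theorem strictAntiOn_flatU (hρ : 0 < ρ) : StrictAntiOn (flatU ρ) (Ioo (-(π / 2)) (π / 2)) := by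
  refine strictAntiOn_of_deriv_neg (convex_Ioo _ _) ?_ fun x hx ↦ ?_
  · intro x hx
    exact (hasDerivAt_flatU (Real.cos_pos_of_mem_Ioo hx).ne').continuousAt.continuousWithinAt
  · rw [interior_Ioo] at hx
    have hc := Real.cos_pos_of_mem_Ioo hx
    rw [(hasDerivAt_flatU hc.ne').deriv]
    have : 0 < ρ * (1 / Real.cos x ^ 2) := by positivity
    linarith

end PathPos

end Literature.Topology.FourManifolds
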